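import Mathlib
import Summits.Schanuel.Schanuel.Theses.RigidCore
import Summits.Schanuel.Schanuel.Theorems.RigidCoreMinimalCounterexampleInAclHitSetRingDefinable
import Summits.Schanuel.Schanuel.Theorems.RigidCoreMinimalCounterexampleInAclZeroInBoxPi
import Summits.Schanuel.Schanuel.Theorems.RigidCoreMinimalCounterexampleInAclCorankGeTwoHitSetBox

/-!
# S7a PROVED: the hit pattern of the LOG PART of a corank ≥ 2 first failure is `∅`-definable in the ring `ℤ`
# (crux stmt-Schanuel-0969 `RigidCore.MinimalCounterexampleInAcl`, line kernel-arithmetic-selection, lead c13)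

`--supports stmt-Schanuel-0969`; registered stub `stub_corankGeTwo_hitSetRingDefinable` (S7a of skeleton gen 28).  For a
normal-form first failure `x` of rank `n` with log coordinates at the indices `i < r` (`e^{x_i} ∈ ℚ̄`), the HIT PATTERN OF THE LOG PART

  `H_x = {κ ∈ ℤⁿ : κ_i = 0 for i ≥ r, and (x_i + 2πiκ_i)_{i<r} is the log part of a mate of x}`

is `∅`-definable in `(ℤ, +, ·)` for every compatible ring structure — i.e. ARITHMETICAL.  This is the corank-free form of S8‴
(`stub_corankOne_hitSetRingDefinable`, Theorems/…HitSetRingDefinable, p138742), assembled the same way from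

* the PRESENTATION through an isolating rational box of `ℂⁿ` (`stub_corankGeTwo_hitSetBox`, Theorems/…CorankGeTwoHitSetBox — the
  input is now the ISOLATION of mates, `firstFailure_khovanskii` + the inverse function theorem, instead of finiteness of the slice);
* "`∃` zero in a closed rational box of `ℂⁿ`" is FIRST ORDER over `ℤ` for continuous non-negative functions whose values at
  Gaussian-rational points form a ring-definable family (`stub_existsZeroInBox_pi`, Theorems/…ZeroInBoxPi);
* the coordinate families of `(x'(κ, q), e^{x'(κ,q)})`, `x'(κ, z)_i = x_i + 2πiκ_i` (`i < r`), `= z_i` (`i ≥ r`), at Gaussian-rational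
  test tuples `q` are ring-definable (`defC_mateCoordPi`, from …HitSetConstants / …BoxArithComplex / …ExpEnclosure).

With the landed glue `logCoords_mem_expAcl_of_ringDefinable_of_noFullLine` (Theorems/…CorankGeTwoLogPart, p141402) this puts the LOG
COORDINATES of every corank ≥ 2 first failure in `acl^{ℂ_exp}(∅)` modulo the no-full-line stub S7b.

References: status note `Cruxes/MinimalCounterexampleInAcl/Lines/kernel_arithmetic_selection.md` §Addendum c12/c13; K. Weihrauch,
*Computable Analysis* (2000), §6.3; H. Rogers (1967), §14–15.
-/

noncomputable section

-- the summit namespace `Summit.Schanuel.Schanuel.…` repeats a component by design (D-0022)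
set_option linter.dupNamespace false

open Set FirstOrder FirstOrder.Language Filter Topology

namespace Summit.Schanuel.Schanuel.Cruxes.MinimalCounterexampleInAcl.KernelArithmeticSelection

open Literature.ModelTheory.ExponentialFields Literature.NumberTheory.Transcendental

variable {n : ℕ}

/-! ## Continuity of the presentation coordinates -/

/-- Evaluation of a fixed rational polynomial at coordinates depending continuously on a tuple `z ∈ ℂⁿ` is continuous. [folklore] -/
theorem continuous_mvPolynomial_aeval_pi {ι : Type*} (p : MvPolynomial ι ℚ) {P : (Fin n → ℂ) → ι → ℂ}
    (hP : ∀ i, Continuous fun z => P z i) : Continuous fun z => MvPolynomial.aeval (P z) p := by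
  induction p using MvPolynomial.induction_on with
  | C a => simp only [MvPolynomial.aeval_C]; exact continuous_const
  | add p q hp hq => simp only [map_add]; exact hp.add hq
  | mul_X p i hp => simp only [map_mul, MvPolynomial.aeval_X]; exact hp.mul (hP i)

/-- The coordinates of `(x'(κ, z), e^{x'(κ,z)})`, `x'(κ, z)_i = x_i + 2πiκ_i` for `i < r` and `= z_i` for `i ≥ r`, depend continuously on
`z ∈ ℂⁿ`. [folklore] -/
theorem continuous_mateCoordPi (r : ℕ) (x : Fin n → ℂ) (κ : Fin n → ℤ) (i : Fin n ⊕ Fin n) :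
    Continuous fun z : Fin n → ℂ => (Sum.elim
      (fun i : Fin n => if (i : ℕ) < r then x i + 2 * ↑Real.pi * Complex.I * (κ i : ℂ) else z i)
      (Complex.exp ∘ fun i : Fin n => if (i : ℕ) < r then x i + 2 * ↑Real.pi * Complex.I * (κ i : ℂ) else z i) : Fin n ⊕ Fin n → ℂ) i := by
  rcases i with j | j
  · by_cases hj : (j : ℕ) < r
    · simp only [Sum.elim_inl, hj, if_true]; exact continuous_const
    · simp only [Sum.elim_inl, hj, if_false]; exact continuous_apply j
  · by_cases hj : (j : ℕ) < r
    · simp only [Sum.elim_inr, Function.comp_apply, hj, if_true]; exact continuous_const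
    · simp only [Sum.elim_inr, Function.comp_apply, hj, if_false]; exact Complex.continuous_exp.comp (continuous_apply j)

/-! ## The coordinate families at Gaussian-rational test tuples are ring-definable -/

section RingZ

variable [FirstOrder.Ring.CompatibleRing ℤ]

/-- **The coordinates of `(x'(κ, q), e^{x'(κ, q)})` at the Gaussian-rational tuple `q_j = (a_j + b_j i)/c` are ring-definable complex families
of `(κ, a, b, c) ∈ ℤⁿ × ℤⁿ × ℤⁿ × ℤ`**, for `x` with `e^{x_i}` algebraic at the log indices `i < r`: there `x_i` is a logarithm of an algebraic
number and `2πi`, `e^{x_i + 2πiκ_i} = e^{x_i}` are ring-definable constants (…HitSetConstants); elsewhere `q_j` and `e^{q_j}` are ring-definable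
(…BoxArithComplex, …ExpEnclosure). [folklore] -/
theorem defC_mateCoordPi (r : ℕ) (x : Fin n → ℂ) (halg : ∀ i : Fin n, (i : ℕ) < r → IsAlgebraic ℚ (Complex.exp (x i)))
    (i : Fin n ⊕ Fin n) :
    ((∅ : Set ℤ).Definable Language.ring {w : _ ⊕ Fin 2 → ℤ | 0 < w (Sum.inr 1) ∧ ((w (Sum.inr 0) : ℤ) : ℝ) < ((w (Sum.inr 1) : ℤ) : ℝ) * ((Complex.re ∘ (fun w : Fin n ⊕ ((Fin n ⊕ Fin n) ⊕ Fin 1) → ℤ => (Sum.elim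
      (fun i : Fin n => if (i : ℕ) < r then x i + 2 * ↑Real.pi * Complex.I * ((w (Sum.inl i) : ℤ) : ℂ) else
        ((((w (Sum.inr (Sum.inl (Sum.inl i)))) : ℤ) : ℂ) + (((w (Sum.inr (Sum.inl (Sum.inr i)))) : ℤ) : ℂ) * Complex.I) / (((w (Sum.inr (Sum.inr 0))) : ℤ) : ℂ))
      (Complex.exp ∘ fun i : Fin n => if (i : ℕ) < r then x i + 2 * ↑Real.pi * Complex.I * ((w (Sum.inl i) : ℤ) : ℂ) else
        ((((w (Sum.inr (Sum.inl (Sum.inl i)))) : ℤ) : ℂ) + (((w (Sum.inr (Sum.inl (Sum.inr i)))) : ℤ) : ℂ) * Complex.I) / (((w (Sum.inr (Sum.inr 0))) : ℤ) : ℂ)) :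
      Fin n ⊕ Fin n → ℂ) i)) ∘ fun w' s => w' (Sum.inl s)) w} ∧ (∅ : Set ℤ).Definable Language.ring {w : _ ⊕ Fin 2 → ℤ | 0 < w (Sum.inr 1) ∧ ((w (Sum.inr 0) : ℤ) : ℝ) < ((w (Sum.inr 1) : ℤ) : ℝ) * ((Complex.im ∘ (fun w : Fin n ⊕ ((Fin n ⊕ Fin n) ⊕ Fin 1) → ℤ => (Sum.elim
      (fun i : Fin n => if (i : ℕ) < r then x i + 2 * ↑Real.pi * Complex.I * ((w (Sum.inl i) : ℤ) : ℂ) else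
        ((((w (Sum.inr (Sum.inl (Sum.inl i)))) : ℤ) : ℂ) + (((w (Sum.inr (Sum.inl (Sum.inr i)))) : ℤ) : ℂ) * Complex.I) / (((w (Sum.inr (Sum.inr 0))) : ℤ) : ℂ))
      (Complex.exp ∘ fun i : Fin n => if (i : ℕ) < r then x i + 2 * ↑Real.pi * Complex.I * ((w (Sum.inl i) : ℤ) : ℂ) else
        ((((w (Sum.inr (Sum.inl (Sum.inl i)))) : ℤ) : ℂ) + (((w (Sum.inr (Sum.inl (Sum.inr i)))) : ℤ) : ℂ) * Complex.I) / (((w (Sum.inr (Sum.inr 0))) : ℤ) : ℂ)) :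
      Fin n ⊕ Fin n → ℂ) i)) ∘ fun w' s => w' (Sum.inl s)) w}) := by
  -- the four kinds of coordinates as families of `w`
  have hu : ∀ j : Fin n, (j : ℕ) < r → ((∅ : Set ℤ).Definable Language.ring {w : _ ⊕ Fin 2 → ℤ | 0 < w (Sum.inr 1) ∧ ((w (Sum.inr 0) : ℤ) : ℝ) < ((w (Sum.inr 1) : ℤ) : ℝ) * ((Complex.re ∘ (fun w : Fin n ⊕ ((Fin n ⊕ Fin n) ⊕ Fin 1) → ℤ =>
      x j + 2 * ↑Real.pi * Complex.I * ((w (Sum.inl j) : ℤ) : ℂ))) ∘ fun w' s => w' (Sum.inl s)) w} ∧ (∅ : Set ℤ).Definable Language.ring {w : _ ⊕ Fin 2 → ℤ | 0 < w (Sum.inr 1) ∧ ((w (Sum.inr 0) : ℤ) : ℝ) < ((w (Sum.inr 1) : ℤ) : ℝ) * ((Complex.im ∘ (fun w : Fin n ⊕ ((Fin n ⊕ Fin n) ⊕ Fin 1) → ℤ =>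
      x j + 2 * ↑Real.pi * Complex.I * ((w (Sum.inl j) : ℤ) : ℂ))) ∘ fun w' s => w' (Sum.inl s)) w}) := fun j hj =>
    defC_add (defC_const_of_isAlgebraic_cexp (halg j hj))
      (defC_mul defC_const_twoPiI (defC_intCast (definableFun_proj_params _)))
  have ht : ∀ j : Fin n, ((∅ : Set ℤ).Definable Language.ring {w : _ ⊕ Fin 2 → ℤ | 0 < w (Sum.inr 1) ∧ ((w (Sum.inr 0) : ℤ) : ℝ) < ((w (Sum.inr 1) : ℤ) : ℝ) * ((Complex.re ∘ (fun w : Fin n ⊕ ((Fin n ⊕ Fin n) ⊕ Fin 1) → ℤ =>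
      ((((w (Sum.inr (Sum.inl (Sum.inl j)))) : ℤ) : ℂ) + (((w (Sum.inr (Sum.inl (Sum.inr j)))) : ℤ) : ℂ) * Complex.I) / (((w (Sum.inr (Sum.inr 0))) : ℤ) : ℂ))) ∘ fun w' s => w' (Sum.inl s)) w} ∧ (∅ : Set ℤ).Definable Language.ring {w : _ ⊕ Fin 2 → ℤ | 0 < w (Sum.inr 1) ∧ ((w (Sum.inr 0) : ℤ) : ℝ) < ((w (Sum.inr 1) : ℤ) : ℝ) * ((Complex.im ∘ (fun w : Fin n ⊕ ((Fin n ⊕ Fin n) ⊕ Fin 1) → ℤ =>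
      ((((w (Sum.inr (Sum.inl (Sum.inl j)))) : ℤ) : ℂ) + (((w (Sum.inr (Sum.inl (Sum.inr j)))) : ℤ) : ℂ) * Complex.I) / (((w (Sum.inr (Sum.inr 0))) : ℤ) : ℂ))) ∘ fun w' s => w' (Sum.inl s)) w}) := fun j =>
    defC_testPoint (definableFun_proj_params _) (definableFun_proj_params _) (definableFun_proj_params _)
  have he : ∀ j : Fin n, ((∅ : Set ℤ).Definable Language.ring {w : _ ⊕ Fin 2 → ℤ | 0 < w (Sum.inr 1) ∧ ((w (Sum.inr 0) : ℤ) : ℝ) < ((w (Sum.inr 1) : ℤ) : ℝ) * ((Complex.re ∘ (fun w : Fin n ⊕ ((Fin n ⊕ Fin n) ⊕ Fin 1) → ℤ =>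
      Complex.exp (((((w (Sum.inr (Sum.inl (Sum.inl j)))) : ℤ) : ℂ) + (((w (Sum.inr (Sum.inl (Sum.inr j)))) : ℤ) : ℂ) * Complex.I) / (((w (Sum.inr (Sum.inr 0))) : ℤ) : ℂ)))) ∘ fun w' s => w' (Sum.inl s)) w} ∧ (∅ : Set ℤ).Definable Language.ring {w : _ ⊕ Fin 2 → ℤ | 0 < w (Sum.inr 1) ∧ ((w (Sum.inr 0) : ℤ) : ℝ) < ((w (Sum.inr 1) : ℤ) : ℝ) * ((Complex.im ∘ (fun w : Fin n ⊕ ((Fin n ⊕ Fin n) ⊕ Fin 1) → ℤ =>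
      Complex.exp (((((w (Sum.inr (Sum.inl (Sum.inl j)))) : ℤ) : ℂ) + (((w (Sum.inr (Sum.inl (Sum.inr j)))) : ℤ) : ℂ) * Complex.I) / (((w (Sum.inr (Sum.inr 0))) : ℤ) : ℂ)))) ∘ fun w' s => w' (Sum.inl s)) w}) := fun j =>
    defC_cexp_gaussRat (definableFun_proj_params _) (definableFun_proj_params _) (definableFun_proj_params _)
  rcases i with j | j
  · by_cases hj : (j : ℕ) < r
    · exact defC_congr (hu j hj) fun w => by simp [hj]
    · exact defC_congr (ht j) fun w => by simp [hj]
  · by_cases hj : (j : ℕ) < r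
    · exact defC_congr (defC_const_of_isAlgebraic (σ := Fin n ⊕ ((Fin n ⊕ Fin n) ⊕ Fin 1)) (halg j hj)) fun w => by
        simp only [Sum.elim_inr, Function.comp_apply, hj, if_true]
        rw [cexp_add_two_pi_I_int]
    · exact defC_congr (he j) fun w => by simp [hj]

end RingZ

/-! ## The registered stub S7a -/

set_option maxHeartbeats 800000 in
set_option linter.unusedVariables false in -- the registered signature names the instance binder `inst`
/-- **Stub S7a — THE HIT PATTERN OF THE LOG PART IS RING-DEFINABLE OVER `ℤ` (corank ≥ 2; PROVED modulo the two wave-1 helper stubs, taken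
here as hypotheses `hW1` = `stub_existsZeroInBox_pi`, `hW2` = `stub_corankGeTwo_hitSetBox`).**  For a normal-form first failure `x` of rank
`n ≥ 3` with `r ≤ n − 2` log directions, the set of `κ ∈ ℤⁿ` vanishing off the log coordinates such that `(x_i + 2πiκ_i)_{i<r}` is the log part
of a mate of `x` is `∅`-definable in the ring `ℤ`. [folklore] -/
theorem corankGeTwo_hitSetRingDefinable_of_helpers
    (hW1 : ∀ [inst : FirstOrder.Ring.CompatibleRing ℤ] (s k : ℕ) (g : (Fin s → ℤ) → (Fin k → ℂ) → ℝ), (∀ v, Continuous (g v)) → (∀ v z, 0 ≤ g v z) → (∅ : Set ℤ).Definable FirstOrder.Language.ring {w : (Fin s ⊕ ((Fin k ⊕ Fin k) ⊕ Fin 1)) ⊕ Fin 2 → ℤ | 0 < w (Sum.inr 1) ∧ ((w (Sum.inr 0) : ℤ) : ℝ) < ((w (Sum.inr 1) : ℤ) : ℝ) * g (fun i => w (Sum.inl (Sum.inl i))) (fun j => ((((w (Sum.inl (Sum.inr (Sum.inl (Sum.inl j))))) : ℤ) : ℂ) + (((w (Sum.inl (Sum.inr (Sum.inl (Sum.inr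 j))))) : ℤ) : ℂ) * Complex.I) / (((w (Sum.inl (Sum.inr (Sum.inr 0)))) : ℤ) : ℂ))} → (∅ : Set ℤ).Definable FirstOrder.Language.ring {u : Fin s ⊕ (((Fin k ⊕ Fin k) ⊕ (Fin k ⊕ Fin k)) ⊕ Fin 1) → ℤ | 0 < u (Sum.inr (Sum.inr 0)) ∧ ∃ z : Fin k → ℂ, (∀ j : Fin k, (((u (Sum.inr (Sum.inl (Sum.inl (Sum.inl j))))) : ℤ) : ℝ) / (((u (Sum.inr (Sum.inr 0))) : ℤ) : ℝ) ≤ (z j).re ∧ (z j).re ≤ (((u (Sum.inr (Sum.inl (Sum.inl (Sum.inr j))))) : ℤ) : ℝ) / (((u (Sum.inr (Sum.inr 0))) : ℤ) : ℝ) ∧ (((u (Sum.inr (Sum.inl (Sum.inr (Sum.inl j))))) : ℤ) : ℝ) / (((u (Sum.inr (Sum.inr 0))) : ℤ) : ℝ) ≤ (z j).im ∧ (z j).im ≤ (((u (Sum.inr (Sum.inl (Sum.inr (Sum.inr j))))) : ℤ) : ℝ) / (((u (Sum.inr (Sum.inr 0))) : ℤ) : ℝ)) ∧ g (fun i => u (Sum.inl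 i)) z = 0})
    (hW2 : ∀ (n r : ℕ) (x : Fin n → ℂ), x ∈ Summit.Schanuel.Schanuel.Cruxes.MinimalCounterexampleInAcl.KernelArithmeticSelection.firstFailures n → ∀ (κ : Fin n → ℤ) (F : (Fin n → ℂ) → ℝ) (G : (Fin n → ℤ) → (Fin n → ℂ) → ℝ), (∀ z : Fin n → ℂ, F z = 0 ↔ (fun i : Fin n => if (i : ℕ) < r then x i + 2 * ↑Real.pi * Complex.I * (κ i : ℂ) else z i) ∈ Summit.Schanuel.Schanuel.Cruxes.MinimalCounterexampleInAcl.KernelArithmeticSelection.locusPts x) → (∀ (N : Fin n → ℤ) (z : Fin n → ℂ), G N z = 0 ↔ (fun i : Fin n => if (i : ℕ) < r then x i + 2 * ↑Real.pi * Complex.I * (κ i : ℂ) else z i) ∈ Summit.Schanuel.Schanuel.Cruxes.MinimalCounterexampleInAcl.KernelArithmeticSelection.locusPts x ∧ ∑ i, (N i : ℂ) * (fun i : Fin n => if (i : ℕ) < r then x i + 2 * ↑Real.pi * Complex.I * (κ i : ℂ) else z i) i = 0) → ((∃ x' ∈ Summit.Schanuel.Schanuel.Cruxes.MinimalCounterexampleInAcl.KernelArithmeticSelection.locusMates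 x, ∀ i : Fin n, (i : ℕ) < r → x' i = x i + 2 * ↑Real.pi * Complex.I * (κ i : ℂ)) ↔ ∃ b : ((Fin n ⊕ Fin n) ⊕ (Fin n ⊕ Fin n)) ⊕ Fin 1 → ℤ, 0 < b (Sum.inr 0) ∧ (∃ z : Fin n → ℂ, (∀ j : Fin n, (((b (Sum.inl (Sum.inl (Sum.inl j)))) : ℤ) : ℝ) / (((b (Sum.inr 0)) : ℤ) : ℝ) ≤ (z j).re ∧ (z j).re ≤ (((b (Sum.inl (Sum.inl (Sum.inr j)))) : ℤ) : ℝ) / (((b (Sum.inr 0)) : ℤ) : ℝ) ∧ (((b (Sum.inl (Sum.inr (Sum.inl j)))) : ℤ) : ℝ) / (((b (Sum.inr 0)) : ℤ) : ℝ) ≤ (z j).im ∧ (z j).im ≤ (((b (Sum.inl (Sum.inr (Sum.inr j)))) : ℤ) : ℝ) / (((b (Sum.inr 0)) : ℤ) : ℝ)) ∧ F z = 0) ∧ ∀ N : Fin n → ℤ, N ≠ 0 → ¬ ∃ z : Fin n → ℂ, (∀ j : Fin n, (((b (Sum.inl (Sum.inl (Sum.inl j)))) : ℤ) : ℝ) /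 (((b (Sum.inr 0)) : ℤ) : ℝ) ≤ (z j).re ∧ (z j).re ≤ (((b (Sum.inl (Sum.inl (Sum.inr j)))) : ℤ) : ℝ) / (((b (Sum.inr 0)) : ℤ) : ℝ) ∧ (((b (Sum.inl (Sum.inr (Sum.inl j)))) : ℤ) : ℝ) / (((b (Sum.inr 0)) : ℤ) : ℝ) ≤ (z j).im ∧ (z j).im ≤ (((b (Sum.inl (Sum.inr (Sum.inr j)))) : ℤ) : ℝ) / (((b (Sum.inr 0)) : ℤ) : ℝ)) ∧ G N z = 0)) :
    ∀ (n r : ℕ), 3 ≤ n → r + 2 ≤ n → ∀ (x : Fin n → ℂ), x ∈ firstFailures n →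
      (∀ i : Fin n, (i : ℕ) < r → IsAlgebraic ℚ (Complex.exp (x i))) →
      (∀ M : Fin n → ℤ, (∃ i : Fin n, r ≤ (i : ℕ) ∧ M i ≠ 0) → Transcendental ℚ (Complex.exp (∑ i, (M i : ℂ) * x i))) →
      ∀ [inst : FirstOrder.Ring.CompatibleRing ℤ], (∅ : Set ℤ).Definable FirstOrder.Language.ring
        {κ : Fin n → ℤ | (∀ i : Fin n, r ≤ (i : ℕ) → κ i = 0) ∧
          ∃ x' ∈ locusMates x, ∀ i : Fin n, (i : ℕ) < r → x' i = x i + 2 * ↑Real.pi * Complex.I * (κ i : ℂ)} := by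
  intro n r _hn _hr x hx halg _hpure inst
  obtain ⟨S, hS₁, hS₂⟩ := exists_finset_generators_locusPts x
  -- the presentation functions
  set Y : (Fin n → ℤ) → (Fin n → ℂ) → Fin n → ℂ :=
    fun κ z i => if (i : ℕ) < r then x i + 2 * ↑Real.pi * Complex.I * (κ i : ℂ) else z i with hY
  set F : (Fin n → ℤ) → (Fin n → ℂ) → ℝ :=
    fun κ z => ∑ p ∈ S, Complex.normSq (MvPolynomial.aeval (Sum.elim (Y κ z) (Complex.exp ∘ Y κ z)) p) with hF
  set G : (Fin n → ℤ) → (Fin n → ℤ) → (Fin n → ℂ) → ℝ :=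
    fun κ N z => F κ z + Complex.normSq (∑ i, (N i : ℂ) * Y κ z i) with hG
  -- zero sets
  have hFiff : ∀ κ z, F κ z = 0 ↔ Y κ z ∈ locusPts x := by
    intro κ z
    rw [hF]
    simp only
    rw [Finset.sum_eq_zero_iff_of_nonneg (fun p _ => Complex.normSq_nonneg _)]
    simp only [Complex.normSq_eq_zero]
    constructor
    · intro h; exact hS₂ _ h
    · intro h p hp; exact h p (hS₁ p hp)
  have hF0 : ∀ κ z, 0 ≤ F κ z := fun κ z => Finset.sum_nonneg fun p _ => Complex.normSq_nonneg _
  have hGiff : ∀ κ N z, G κ N z = 0 ↔ Y κ z ∈ locusPts x ∧ ∑ i, (N i : ℂ) * Y κ z i = 0 := by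
    intro κ N z
    rw [hG]
    simp only
    rw [add_eq_zero_iff_of_nonneg (hF0 κ z) (Complex.normSq_nonneg _), hFiff, Complex.normSq_eq_zero]
  have hG0 : ∀ κ N z, 0 ≤ G κ N z := fun κ N z => add_nonneg (hF0 κ z) (Complex.normSq_nonneg _)
  -- continuity
  have hFc : ∀ κ, Continuous (F κ) := fun κ => by
    rw [hF]
    refine continuous_finsetSum S fun p _ => Complex.continuous_normSq.comp ?_
    exact continuous_mvPolynomial_aeval_pi p (continuous_mateCoordPi r x κ)
  have hGc : ∀ κ N, Continuous (G κ N) := fun κ N => by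
    rw [hG]
    refine (hFc κ).add (Complex.continuous_normSq.comp (continuous_finsetSum _ fun i _ => ?_))
    exact continuous_const.mul (continuous_mateCoordPi r x κ (Sum.inl i))
  -- definability of the values at Gaussian-rational test tuples
  have hFdef : (∅ : Set ℤ).Definable Language.ring {w : _ ⊕ Fin 2 → ℤ | 0 < w (Sum.inr 1) ∧ ((w (Sum.inr 0) : ℤ) : ℝ) < ((w (Sum.inr 1) : ℤ) : ℝ) * ((fun w : Fin n ⊕ ((Fin n ⊕ Fin n) ⊕ Fin 1) → ℤ => F (fun i => w (Sum.inl i))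
      (fun j => ((((w (Sum.inr (Sum.inl (Sum.inl j)))) : ℤ) : ℂ) + (((w (Sum.inr (Sum.inl (Sum.inr j)))) : ℤ) : ℂ) * Complex.I) / (((w (Sum.inr (Sum.inr 0))) : ℤ) : ℂ))) ∘ fun w' s => w' (Sum.inl s)) w} := by
    have h := defR_sumNormSqAeval S (defC_mateCoordPi r x halg)
    refine defR_congr h fun w => ?_
    rw [hF, hY]
  have hLdef : ((∅ : Set ℤ).Definable Language.ring {w : _ ⊕ Fin 2 → ℤ | 0 < w (Sum.inr 1) ∧ ((w (Sum.inr 0) : ℤ) : ℝ) < ((w (Sum.inr 1) : ℤ) : ℝ) * ((Complex.re ∘ (fun w : (Fin n ⊕ ((Fin n ⊕ Fin n) ⊕ Fin 1)) ⊕ Fin n → ℤ => ∑ i, ((w (Sum.inr i) : ℤ) : ℂ) *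
      Y (fun i => w (Sum.inl (Sum.inl i)))
        (fun j => ((((w (Sum.inl (Sum.inr (Sum.inl (Sum.inl j))))) : ℤ) : ℂ) + (((w (Sum.inl (Sum.inr (Sum.inl (Sum.inr j))))) : ℤ) : ℂ) * Complex.I) / (((w (Sum.inl (Sum.inr (Sum.inr 0)))) : ℤ) : ℂ)) i)) ∘ fun w' s => w' (Sum.inl s)) w} ∧ (∅ : Set ℤ).Definable Language.ring {w : _ ⊕ Fin 2 → ℤ | 0 < w (Sum.inr 1) ∧ ((w (Sum.inr 0) : ℤ) : ℝ) < ((w (Sum.inr 1) : ℤ) : ℝ) * ((Complex.im ∘ (fun w : (Fin n ⊕ ((Fin n ⊕ Fin n) ⊕ Fin 1)) ⊕ Fin n → ℤ => ∑ i, ((w (Sum.inr i) : ℤ) : ℂ) *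
      Y (fun i => w (Sum.inl (Sum.inl i)))
        (fun j => ((((w (Sum.inl (Sum.inr (Sum.inl (Sum.inl j))))) : ℤ) : ℂ) + (((w (Sum.inl (Sum.inr (Sum.inl (Sum.inr j))))) : ℤ) : ℂ) * Complex.I) / (((w (Sum.inl (Sum.inr (Sum.inr 0)))) : ℤ) : ℂ)) i)) ∘ fun w' s => w' (Sum.inl s)) w}) := by
    refine defC_sum Finset.univ fun i _ => defC_mul (defC_intCast (definableFun_proj_params _)) ?_
    have h := defC_reindex (defC_mateCoordPi r x halg (Sum.inl i)) (Sum.inl : (Fin n ⊕ ((Fin n ⊕ Fin n) ⊕ Fin 1)) → (Fin n ⊕ ((Fin n ⊕ Fin n) ⊕ Fin 1)) ⊕ Fin n)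
    refine defC_congr h fun w => ?_
    rw [hY]
    simp only [Sum.elim_inl]
  have hGdef : (∅ : Set ℤ).Definable Language.ring {w : _ ⊕ Fin 2 → ℤ | 0 < w (Sum.inr 1) ∧ ((w (Sum.inr 0) : ℤ) : ℝ) < ((w (Sum.inr 1) : ℤ) : ℝ) * ((fun w : (Fin n ⊕ ((Fin n ⊕ Fin n) ⊕ Fin 1)) ⊕ Fin n → ℤ => G (fun i => w (Sum.inl (Sum.inl i)))
      (fun i => w (Sum.inr i))
      (fun j => ((((w (Sum.inl (Sum.inr (Sum.inl (Sum.inl j))))) : ℤ) : ℂ) + (((w (Sum.inl (Sum.inr (Sum.inl (Sum.inr j))))) : ℤ) : ℂ) * Complex.I) / (((w (Sum.inl (Sum.inr (Sum.inr 0)))) : ℤ) : ℂ))) ∘ fun w' s => w' (Sum.inl s)) w} :=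
    defR_add (defR_reindex hFdef (Sum.inl : (Fin n ⊕ ((Fin n ⊕ Fin n) ⊕ Fin 1)) → (Fin n ⊕ ((Fin n ⊕ Fin n) ⊕ Fin 1)) ⊕ Fin n)) (defR_normSq hLdef)
  -- "∃ zero in a box" as definable conditions on `(κ, b)` and on `((κ, N), b)`
  have hA := @hW1 inst n n F hFc hF0 hFdef
  -- pack `(κ, N)` into `Fin (n + n)` for the second application
  set gB : (Fin (n + n) → ℤ) → (Fin n → ℂ) → ℝ :=
    fun v z => G (fun i => v (Fin.castAdd n i)) (fun i => v (Fin.natAdd n i)) z with hgB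
  have hgBc : ∀ v, Continuous (gB v) := fun v => hGc _ _
  have hgB0 : ∀ v z, 0 ≤ gB v z := fun v z => hG0 _ _ z
  have hgBdef : (∅ : Set ℤ).Definable Language.ring {w : _ ⊕ Fin 2 → ℤ | 0 < w (Sum.inr 1) ∧ ((w (Sum.inr 0) : ℤ) : ℝ) < ((w (Sum.inr 1) : ℤ) : ℝ) * ((fun w : Fin (n + n) ⊕ ((Fin n ⊕ Fin n) ⊕ Fin 1) → ℤ => gB (fun i => w (Sum.inl i))
      (fun j => ((((w (Sum.inr (Sum.inl (Sum.inl j)))) : ℤ) : ℂ) + (((w (Sum.inr (Sum.inl (Sum.inr j)))) : ℤ) : ℂ) * Complex.I) / (((w (Sum.inr (Sum.inr 0))) : ℤ) : ℂ))) ∘ fun w' s => w' (Sum.inl s)) w} := by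
    have h := defR_reindex hGdef (Sum.elim (Sum.elim (fun i => Sum.inl (Fin.castAdd n i)) Sum.inr) (fun i => Sum.inl (Fin.natAdd n i)) :
      (Fin n ⊕ ((Fin n ⊕ Fin n) ⊕ Fin 1)) ⊕ Fin n → Fin (n + n) ⊕ ((Fin n ⊕ Fin n) ⊕ Fin 1))
    refine (defR_congr h fun w => ?_)
    rw [hgB]
    simp only [Sum.elim_inl, Sum.elim_inr]
  have hB := @hW1 inst (n + n) n gB hgBc hgB0 hgBdef
  -- bring `hB` to the parameter shape `((κ, b), N)`: reindex along `ρ : Fin (n+n) ⊕ box → (Fin n ⊕ box) ⊕ Fin n`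
  have hB' := Set.Definable.preimage_comp
    (Sum.elim (Fin.addCases (fun i => Sum.inl (Sum.inl i)) (fun i => Sum.inr i)) (fun t => Sum.inl (Sum.inr t)) :
      Fin (n + n) ⊕ (((Fin n ⊕ Fin n) ⊕ (Fin n ⊕ Fin n)) ⊕ Fin 1) → (Fin n ⊕ (((Fin n ⊕ Fin n) ⊕ (Fin n ⊕ Fin n)) ⊕ Fin 1)) ⊕ Fin n) hB
  -- the support condition is a finite conjunction of coordinate equations
  have hsupp : (∅ : Set ℤ).Definable Language.ring {κ : Fin n → ℤ | ∀ i : Fin n, r ≤ (i : ℕ) → κ i = 0} := by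
    refine definable_setOf_forallFin fun i => ?_
    by_cases hi : r ≤ (i : ℕ)
    · have e : {κ : Fin n → ℤ | r ≤ (i : ℕ) → κ i = 0} = {κ : Fin n → ℤ | κ i = 0} := by
        ext κ; simp [hi]
      rw [e]
      exact definable_setOf_eq_params (definableFun_proj_params i) ringDefinableFun_zero
    · have e : {κ : Fin n → ℤ | r ≤ (i : ℕ) → κ i = 0} = Set.univ := by
        ext κ; simp [hi]
      rw [e]
      exact Set.definable_univ
  -- the first-order definition of the hit pattern
  have hdef : (∅ : Set ℤ).Definable Language.ring {κ : Fin n → ℤ | (∀ i : Fin n, r ≤ (i : ℕ) → κ i = 0) ∧ ∃ b : ((Fin n ⊕ Fin n) ⊕ (Fin n ⊕ Fin n)) ⊕ Fin 1 → ℤ,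
      (Sum.elim κ b) ∈ {u : Fin n ⊕ (((Fin n ⊕ Fin n) ⊕ (Fin n ⊕ Fin n)) ⊕ Fin 1) → ℤ | 0 < u (Sum.inr (Sum.inr 0)) ∧ ∃ z : Fin n → ℂ,
        (∀ j : Fin n, (((u (Sum.inr (Sum.inl (Sum.inl (Sum.inl j))))) : ℤ) : ℝ) / (((u (Sum.inr (Sum.inr 0))) : ℤ) : ℝ) ≤ (z j).re ∧
          (z j).re ≤ (((u (Sum.inr (Sum.inl (Sum.inl (Sum.inr j))))) : ℤ) : ℝ) / (((u (Sum.inr (Sum.inr 0))) : ℤ) : ℝ) ∧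
          (((u (Sum.inr (Sum.inl (Sum.inr (Sum.inl j))))) : ℤ) : ℝ) / (((u (Sum.inr (Sum.inr 0))) : ℤ) : ℝ) ≤ (z j).im ∧
          (z j).im ≤ (((u (Sum.inr (Sum.inl (Sum.inr (Sum.inr j))))) : ℤ) : ℝ) / (((u (Sum.inr (Sum.inr 0))) : ℤ) : ℝ)) ∧
        F (fun i => u (Sum.inl i)) z = 0} ∧
      ∀ N : Fin n → ℤ, (¬ ∀ i, N i = 0) →
        ¬ (Sum.elim (Sum.elim κ b) N) ∈ ((fun g : (Fin n ⊕ (((Fin n ⊕ Fin n) ⊕ (Fin n ⊕ Fin n)) ⊕ Fin 1)) ⊕ Fin n → ℤ =>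
            g ∘ (Sum.elim (Fin.addCases (fun i => Sum.inl (Sum.inl i)) (fun i => Sum.inr i)) (fun t => Sum.inl (Sum.inr t)) :
              Fin (n + n) ⊕ (((Fin n ⊕ Fin n) ⊕ (Fin n ⊕ Fin n)) ⊕ Fin 1) → (Fin n ⊕ (((Fin n ⊕ Fin n) ⊕ (Fin n ⊕ Fin n)) ⊕ Fin 1)) ⊕ Fin n)) ⁻¹'
          {u : Fin (n + n) ⊕ (((Fin n ⊕ Fin n) ⊕ (Fin n ⊕ Fin n)) ⊕ Fin 1) → ℤ | 0 < u (Sum.inr (Sum.inr 0)) ∧ ∃ z : Fin n → ℂ,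
            (∀ j : Fin n, (((u (Sum.inr (Sum.inl (Sum.inl (Sum.inl j))))) : ℤ) : ℝ) / (((u (Sum.inr (Sum.inr 0))) : ℤ) : ℝ) ≤ (z j).re ∧
              (z j).re ≤ (((u (Sum.inr (Sum.inl (Sum.inl (Sum.inr j))))) : ℤ) : ℝ) / (((u (Sum.inr (Sum.inr 0))) : ℤ) : ℝ) ∧
              (((u (Sum.inr (Sum.inl (Sum.inr (Sum.inl j))))) : ℤ) : ℝ) / (((u (Sum.inr (Sum.inr 0))) : ℤ) : ℝ) ≤ (z j).im ∧
              (z j).im ≤ (((u (Sum.inr (Sum.inl (Sum.inr (Sum.inr j))))) : ℤ) : ℝ) / (((u (Sum.inr (Sum.inr 0))) : ℤ) : ℝ)) ∧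
            gB (fun i => u (Sum.inl i)) z = 0})} := by
    refine definable_setOf_and_params hsupp (definable_setOf_existsBlock (definable_setOf_and_params ?_ (definable_setOf_forallBlock
      (definable_setOf_imp_params (definable_setOf_not_params (definable_setOf_forallFin fun i =>
        definable_setOf_eq_params (definableFun_proj_params _) ringDefinableFun_zero))
      (definable_setOf_not_params ?_)))))
    · rw [setOf_sumElim_mem]; exact hA
    · rw [setOf_sumElim₂_mem]; exact hB'
  -- the presentation theorem identifies the two sets
  convert hdef using 1
  ext κ
  simp only [mem_setOf_eq]
  refine and_congr_right fun _ => ?_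
  have hb := hW2 n r x hx κ (F κ) (G κ) (hFiff κ) (hGiff κ)
  rw [hb]
  simp only [Sum.elim_inl, Sum.elim_inr, mem_preimage, mem_setOf_eq, Function.comp_apply]
  constructor
  · rintro ⟨b, hb4, hz, hN⟩
    refine ⟨b, ⟨hb4, hz⟩, fun N hN0 h => hN N (fun h0 => hN0 fun i => by rw [h0]; rfl) ?_⟩
    obtain ⟨-, z, hzb, hgz⟩ := h
    refine ⟨z, hzb, ?_⟩
    rw [hgB] at hgz
    simp only [Sum.elim_inl, Sum.elim_inr, Fin.addCases_left, Fin.addCases_right] at hgz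
    exact hgz
  · rintro ⟨b, ⟨hb4, hz⟩, hN⟩
    refine ⟨b, hb4, hz, fun N hN0 h => hN N (fun h0 => hN0 (funext h0)) ⟨hb4, ?_⟩⟩
    obtain ⟨z, hzb, hgz⟩ := h
    refine ⟨z, hzb, ?_⟩
    rw [hgB]
    simp only [Sum.elim_inl, Sum.elim_inr, Fin.addCases_left, Fin.addCases_right]
    exact hgz


/-! ## The registered stub S7a (helpers discharged by the landed wave-1 files) -/

set_option linter.unusedVariables false in -- the registered signature names the instance binder `inst`
/-- **Stub S7a — THE HIT PATTERN OF THE LOG PART OF A CORANK ≥ 2 FIRST FAILURE IS RING-DEFINABLE OVER `ℤ` (PROVED).**  Registered stub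
`stub_corankGeTwo_hitSetRingDefinable` of crux stmt-Schanuel-0969 (skeleton gen 28, line kernel-arithmetic-selection, lead c13):
`corankGeTwo_hitSetRingDefinable_of_helpers` with the landed `stub_existsZeroInBox_pi` (Theorems/…ZeroInBoxPi) and `stub_corankGeTwo_hitSetBox`
(Theorems/…CorankGeTwoHitSetBox). [folklore] -/
theorem stub_corankGeTwo_hitSetRingDefinable : ∀ (n r : ℕ), 3 ≤ n → r + 2 ≤ n → ∀ (x : Fin n → ℂ), x ∈ Summit.Schanuel.Schanuel.Cruxes.MinimalCounterexampleInAcl.KernelArithmeticSelection.firstFailures n → (∀ i : Fin n, (i : ℕ) < r → IsAlgebraic ℚ (Complex.exp (x i))) → (∀ M : Fin n → ℤ, (∃ i : Fin n, r ≤ (i : ℕ) ∧ M i ≠ 0) → Transcendental ℚ (Complex.exp (∑ i, (M i : ℂ) * x i))) → ∀ [inst : FirstOrder.Ring.CompatibleRing ℤ], (∅ : Set ℤ).Definable FirstOrder.Language.ring {κ : Fin n → ℤ | (∀ i : Fin n, r ≤ (i : ℕ) → κ i = 0) ∧ ∃ x' ∈ Summit.Schanuel.Schanuel.Cruxes.MinimalCounterexampleInAcl.KernelArithmeticSelection.locusMates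 x, ∀ i : Fin n, (i : ℕ) < r → x' i = x i + 2 * ↑Real.pi * Complex.I * (κ i : ℂ)} :=
  corankGeTwo_hitSetRingDefinable_of_helpers @stub_existsZeroInBox_pi stub_corankGeTwo_hitSetBox

end Summit.Schanuel.Schanuel.Cruxes.MinimalCounterexampleInAcl.KernelArithmeticSelection

end
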